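import Summits.BirchSwinnertonDyer.BirchSwinnertonDyer.Theorems.GenusKolyvaginAtTwoGenusPrimitiveSupplyAtTwoArchimedeanTwoTorsion
import Summits.BirchSwinnertonDyer.BirchSwinnertonDyer.Theorems.GenusKolyvaginAtTwoGenusPrimitiveSupplyAtTwoTwistLocalConditionSigned
import Literature.NumberTheory.EllipticCurves.LocalKummerMap
import Mathlib.FieldTheory.Galois.Infinite
import HarnessLib

/-!
# Route `GenusKolyvaginAtTwo`, crux #2 `GenusPrimitiveSupplyAtTwo` (stmt-BirchSwinnertonDyer-22136):
# TRANSVERSALITY AT A REAL PLACE of the Kummer lines of `E` and `E^{(d)}` (`Δ_E >_w 0`, `d <_w 0`) for the canonical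
# identification `E^{(d)}[2] ≅ E[2]` — Mazur–Rubin's Lemma 2.9 «even if `v ∣ ∞`», Kramer's Prop. 6

Width seat `bsd-line-gk2-p5` g9 (cell `bsd-f1-sign2`, SUPPLY lineage, «UP general-K lane»), file 23 of the series (sequel of
`…ArchimedeanTwoTorsion.lean`). THEOREMS ONLY (no definition, no named fact, no `sorry`, no local instance); helper
`--supports stmt-BirchSwinnertonDyer-22136`; no item is closed; BSD is not proved by any of this.

WHAT. The last local input (β) = (d) of the archimedean `T`-place programme (crux memo `Lines/genus-supply-mr-instantiation.md` §6–§7),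
i.e. the hypothesis `htr` of file 21 (`GenusKolyArch.natCard_selmerGroup_twist_shift_of_places_inl_of_parity`), PROVED for the canonical
(untwisting) identification of g8's `GenusKolyTwistLocal.exists_addEquiv_geomTorsion_two_localSquare_signed`:

* §57 `map_kummerLocalConditionAt_inf_eq_bot_of_neg_of_isReal` — at a real place `w` with `w(Δ_E) > 0` and `d` a non-square in `K_w`,
  for an intertwining `χ : Wd[2] → E[2]` intertwined on torsion with an untwisting `θ : Wd(K̄_w) ≃+ E(K̄_w)` that ANTI-commutes with
  every `σ ∈ Γ_{K_w}` moving `ι(√d)`: `χ_* 𝓛_w(Wd) ⊓ 𝓛_w(E) = ⊥`. Proof: `Γ_{K_w} = {1, σ₀}` with `σ₀ ι√d = −ι√d` (a non-trivial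
  element fixing `ι√d` would put `√d ∈ K_w`, `InfiniteGalois.mem_range_algebraMap_iff_fixed`); a class in the intersection has a cocycle
  `f` with `ι χ(f σ₀) = σ₀Q − Q` (a Kummer letter of `E`) and `= θ(σ₀Q' − Q') = −(σ₀R + R)` (a negative norm), hence `= 0` by the
  letter–norm lemma of file 22 (`E(K̄_w)` is `2`-divisible, `E(K̄_w)[2]` is `Γ_{K_w}`-fixed since `w(Δ_E) > 0`).
* §58 `exists_intertwining_hsplit_and_transverse_inl` — ONE pair of inverse intertwinings `φ : Wd[2] ≅ E[2] : φ'` which AGREES with the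
  Kummer conditions at every `K`-field where `d` is a square (Lemma 2.10 (i), as g8's `exists_intertwining_hsplit`) AND is TRANSVERSE at
  every real place `w` with `w(Δ_E) > 0` where `d` is not a square — the shape consumed by file 21.

References: [MazurRubin2010] Remark 2.4, Lemma 2.9, Lemma 2.10 (i); [Kramer1981] §2 Prop. 6 (p. 127); [SilvermanAEC2009] X.2 Prop. 2.4, X.5 Cor. 5.4.
-/

set_option linter.dupNamespace false -- tree convention: `Summit.BirchSwinnertonDyer.BirchSwinnertonDyer.Theorems` (summit = sub-problem)
set_option autoImplicit false

noncomputable section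

open scoped Classical ContRepresentation

namespace Summit.BirchSwinnertonDyer.BirchSwinnertonDyer.Theorems.GenusKolyArch

open WeierstrassCurve Field NumberField Function
open Literature.NumberTheory.EllipticCurves Literature.NumberTheory.GaloisRepresentations
open Literature.NumberTheory.GaloisCohomology
open Summit.BirchSwinnertonDyer.BirchSwinnertonDyer.Theorems.GenusKolyTwistLocal

/-! ## §57 Transversality at a real place for an anti-commuting untwisting -/

section Local

variable {K : Type} [Field K] [NumberField K] (W Wd : WeierstrassCurve K) [W.IsElliptic] [Wd.IsElliptic]

/-- At a real place `w` where `d` is not a square, every non-trivial `σ ∈ Γ_{K_w}` maps `ι(√d)` to `−ι(√d)` (`|Γ_{K_w}| ≤ 2` and the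
fixed field of `Γ_{K_w}` on `K̄_w` is `K_w`). [folklore] -/
theorem smul_closureEmb_geomSqrt_eq_neg_of_ne_one {w : InfinitePlace K} {d : K}
    (hdsq : ∀ s : w.Completion, s ^ 2 ≠ algebraMap K w.Completion d)
    (σ : absoluteGaloisGroup w.Completion) (hσ : σ ≠ 1) :
    (show AlgebraicClosure w.Completion ≃ₐ[w.Completion] AlgebraicClosure w.Completion from σ)
        (closureEmb (K := K) w.Completion (geomSqrt d)) =
      -closureEmb (K := K) w.Completion (geomSqrt d) := by
  haveI : CharZero w.Completion := charZero_of_injective_algebraMap (algebraMap K w.Completion).injective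
  haveI := finite_absoluteGaloisGroup_completion_infinitePlace w
  have hG := natCard_absoluteGaloisGroup_completion_infinitePlace_le_two w
  rcases smul_closureEmb_geomSqrt_eq_or_eq_neg (K := K) (d := d) w.Completion σ with h | h
  · exfalso
    have hall : ∀ τ : AlgebraicClosure w.Completion ≃ₐ[w.Completion] AlgebraicClosure w.Completion,
        τ (closureEmb (K := K) w.Completion (geomSqrt d)) = closureEmb (K := K) w.Completion (geomSqrt d) := by
      intro τ
      by_cases hτ : (show absoluteGaloisGroup w.Completion from τ) = 1
      · have h1 : τ = AlgEquiv.refl := hτ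
        rw [h1]
        rfl
      · have hτσ : (show absoluteGaloisGroup w.Completion from τ) = σ := eq_of_ne_one_of_natCard_le_two hG hτ hσ
        have h' := h
        rw [← hτσ] at h'
        exact h'
    haveI : IsGalois w.Completion (AlgebraicClosure w.Completion) := {}
    obtain ⟨s, hs⟩ :=
      (InfiniteGalois.mem_range_algebraMap_iff_fixed (closureEmb (K := K) w.Completion (geomSqrt d))).mpr hall
    have hsq : (closureEmb (K := K) w.Completion (geomSqrt d)) ^ 2 =
        algebraMap K (AlgebraicClosure w.Completion) d := by
      rw [← map_pow, geomSqrt_sq, AlgHom.commutes]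
    apply hdsq s
    apply (algebraMap w.Completion (AlgebraicClosure w.Completion)).injective
    rw [map_pow, hs, hsq, IsScalarTower.algebraMap_apply K w.Completion (AlgebraicClosure w.Completion)]
  · exact h

omit [Wd.IsElliptic] in
/-- **Transversality at a real place (Mazur–Rubin Lemma 2.9 «even if `v ∣ ∞`», Kramer Prop. 6: `N E(ℂ) = 2E(ℝ)`).** `W, Wd` elliptic
over the number field `K`; `w` a real place with `w(Δ_W) > 0`; `d ∈ K` not a square in `K_w`; `χ : Wd[2] → W[2]` an intertwining map
intertwined on `2`-torsion (`hχ`) with an additive untwisting `θ : Wd(K̄_w) ≃+ W(K̄_w)` which ANTI-commutes with every `σ ∈ Γ_{K_w}`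
moving `ι(√d)` (`hneg`; the data of g8's `exists_addEquiv_geomTorsion_two_localSquare_signed` at `E = K_w`). Then the transported
Kummer line of `Wd` and the Kummer line of `W` in `H¹(K_w, W[2])` meet trivially.
[cite: MazurRubin2010, Lemma 2.9] [cite: Kramer1981, §2 Prop. 6 (p. 127)] -/
theorem map_kummerLocalConditionAt_inf_eq_bot_of_neg_of_isReal
    {w : InfinitePlace K} (hw : w.IsReal) (hΔ : 0 < InfinitePlace.embedding_of_isReal hw W.Δ)
    {d : K} (hdsq : ∀ s : w.Completion, s ^ 2 ≠ algebraMap K w.Completion d)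
    (χ : (Wd.torsionGaloisModule ((2 : ℕ) : ℤ)).toContRepresentation →ⁱL
      (W.torsionGaloisModule ((2 : ℕ) : ℤ)).toContRepresentation)
    (θ : localPoints Wd w.Completion ≃+ localPoints W w.Completion)
    (hneg : ∀ σ : absoluteGaloisGroup w.Completion,
      (show AlgebraicClosure w.Completion ≃ₐ[w.Completion] AlgebraicClosure w.Completion from σ)
          (closureEmb (K := K) w.Completion (geomSqrt d)) = -closureEmb (K := K) w.Completion (geomSqrt d) →
      ∀ Q : localPoints Wd w.Completion, θ (σ • Q) = -(σ • θ Q))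
    (hχ : ∀ t : geomTorsion Wd ((2 : ℕ) : ℤ),
      pointsMap W w.Completion (χ t : geomPoints W) = θ (pointsMap Wd w.Completion (t : geomPoints Wd))) :
    (Wd.kummerLocalConditionAt ((2 : ℕ) : ℤ) w.Completion).map
        (galoisCohomology.map (χ.restrictField w.Completion) 1) ⊓
      W.kummerLocalConditionAt ((2 : ℕ) : ℤ) w.Completion = ⊥ := by
  haveI : CharZero w.Completion := charZero_of_injective_algebraMap (algebraMap K w.Completion).injective
  haveI := finite_absoluteGaloisGroup_completion_infinitePlace w
  have hG := natCard_absoluteGaloisGroup_completion_infinitePlace_le_two w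
  obtain ⟨e₁, e₂, e₃, h2⟩ := exists_splitTwoTorsion_completion_of_isReal W hw hΔ
  -- the three inputs of the letter–norm lemma on `A = W(K̄_w)`
  have hσσ : ∀ (σ : absoluteGaloisGroup w.Completion) (a : localPoints W w.Completion),
      DistribSMul.toAddMonoidHom (localPoints W w.Completion) σ (DistribSMul.toAddMonoidHom (localPoints W w.Completion) σ a) = a :=
    fun σ a ↦ by
      rw [DistribSMul.toAddMonoidHom_apply, DistribSMul.toAddMonoidHom_apply, smul_smul,
        mul_self_eq_one_of_natCard_le_two hG σ, one_smul]
  have hdiv := exists_add_self_eq_localPoints W w.Completion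
  have htors : ∀ (σ : absoluteGaloisGroup w.Completion) (t : localPoints W w.Completion), t + t = 0 →
      DistribSMul.toAddMonoidHom (localPoints W w.Completion) σ t = t := fun σ t ht ↦ by
    rw [DistribSMul.toAddMonoidHom_apply]
    exact smul_eq_self_of_add_self_eq_zero_of_splitTwoTorsion W w.Completion h2 σ t ht
  rw [eq_bot_iff]
  rintro x hx
  obtain ⟨hxA, hxW⟩ := AddSubgroup.mem_inf.mp hx
  obtain ⟨x', hx', rfl⟩ := AddSubgroup.mem_map.mp hxA
  obtain ⟨f, rfl⟩ := oneCocycleClass_surjective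
    (DiscreteGaloisModule.toTopRep (GaloisRep.restrictField w.Completion (Wd.torsionGaloisModule ((2 : ℕ) : ℤ)))) x'
  rw [mem_kummerLocalConditionAt_iff, map_torsionPointsMapIntertwining_oneCocycleClass] at hx'
  obtain ⟨Q', hQ'⟩ := (oneCocycleClass_eq_zero_iff _ _).mp hx'
  have hQ'' : ∀ σ : absoluteGaloisGroup w.Completion,
      pointsMap Wd w.Completion ((f.1 σ : geomTorsion Wd ((2 : ℕ) : ℤ)) : geomPoints Wd) = σ • Q' - Q' := hQ'
  rw [galoisCohomology.map_one_oneCocycleClass] at hxW ⊢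
  rw [mem_kummerLocalConditionAt_iff, map_torsionPointsMapIntertwining_oneCocycleClass] at hxW
  obtain ⟨Q, hQ⟩ := (oneCocycleClass_eq_zero_iff _ _).mp hxW
  have hQ2 : ∀ σ : absoluteGaloisGroup w.Completion,
      pointsMap W w.Completion ((χ (f.1 σ) : geomTorsion W ((2 : ℕ) : ℤ)) : geomPoints W) = σ • Q - Q := hQ
  -- every value of the transported cocycle vanishes
  have hzero : ∀ σ : absoluteGaloisGroup w.Completion, χ (f.1 σ) = 0 := by
    intro σ
    suffices h : pointsMap W w.Completion ((χ (f.1 σ) : geomTorsion W ((2 : ℕ) : ℤ)) : geomPoints W) = 0 by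
      have h1 : ((χ (f.1 σ) : geomTorsion W ((2 : ℕ) : ℤ)) : geomPoints W) = 0 :=
        pointsMapOfEmb_injective W _ (by rw [map_zero]; exact h)
      exact Subtype.ext h1
    by_cases hσ : σ = 1
    · rw [hQ2, hσ, one_smul, sub_self]
    · have hB : pointsMap W w.Completion ((χ (f.1 σ) : geomTorsion W ((2 : ℕ) : ℤ)) : geomPoints W) =
          -(σ • θ Q') - θ Q' := by
        rw [hχ, hQ'', map_sub, hneg σ (smul_closureEmb_geomSqrt_eq_neg_of_ne_one hdsq σ hσ)]
      exact eq_zero_of_eq_sub_of_eq_neg_sub (DistribSMul.toAddMonoidHom (localPoints W w.Completion) σ) (hσσ σ) hdiv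
        (htors σ) (hQ2 σ) hB
  rw [AddSubgroup.mem_bot]
  refine (oneCocycleClass_eq_zero_iff _ _).mpr ⟨0, fun σ ↦ ?_⟩
  rw [map_zero, sub_zero]
  change χ (f.1 σ) = 0
  exact hzero σ

end Local

/-! ## §58 ONE identification: agreement at split places AND transversality at real places with `w(Δ) > 0` -/

section Package

variable {K : Type} [Field K] [NumberField K] (W : WeierstrassCurve K) [W.IsElliptic]

/-- **The canonical identification `E^{(d)}[2] ≅ E[2]` agrees with the Kummer conditions at split places (Mazur–Rubin Lemma 2.10 (i)) and
is transverse at every real place `w` with `w(Δ_E) > 0` where `d` is not a square (Lemma 2.9 at `v ∣ ∞` / Kramer Prop. 6)** — one pair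
of inverse intertwinings for both, the shape consumed by `GenusKolyArch.natCard_selmerGroup_twist_shift_of_places_inl_of_parity`.
[cite: MazurRubin2010, Remark 2.4, Lemma 2.9, Lemma 2.10 (i)] [cite: Kramer1981, §2 Prop. 6 (p. 127)] [cite: SilvermanAEC2009, X.5 Cor. 5.4] -/
theorem exists_intertwining_hsplit_and_transverse_inl {d : K} (hd : d ≠ 0) {Wd : WeierstrassCurve K} [Wd.IsElliptic]
    {C : VariableChange K} (hWd : C • W.quadraticTwist d = Wd) :
    ∃ (φ : (Wd.torsionGaloisModule ((2 : ℕ) : ℤ)).toContRepresentation →ⁱL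
        (W.torsionGaloisModule ((2 : ℕ) : ℤ)).toContRepresentation)
      (φ' : (W.torsionGaloisModule ((2 : ℕ) : ℤ)).toContRepresentation →ⁱL
        (Wd.torsionGaloisModule ((2 : ℕ) : ℤ)).toContRepresentation),
      (∀ a, φ' (φ a) = a) ∧ (∀ b, φ (φ' b) = b) ∧
      (∀ (E : Type) [Field E] [Algebra K E], (∃ s : E, s ^ 2 = algebraMap K E d) →
        (Wd.kummerLocalConditionAt ((2 : ℕ) : ℤ) E).map (galoisCohomology.map (φ.restrictField E) 1) =
          W.kummerLocalConditionAt ((2 : ℕ) : ℤ) E) ∧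
      ∀ (w : InfinitePlace K) (hw : w.IsReal), 0 < InfinitePlace.embedding_of_isReal hw W.Δ →
        (∀ s : w.Completion, s ^ 2 ≠ algebraMap K w.Completion d) →
        (Wd.kummerLocalConditionAt ((2 : ℕ) : ℤ) w.Completion).map
            (galoisCohomology.map (φ.restrictField w.Completion) 1) ⊓
          W.kummerLocalConditionAt ((2 : ℕ) : ℤ) w.Completion = ⊥ := by
  haveI : NeZero (2 : K) := ⟨two_ne_zero⟩
  obtain ⟨ψ, hψ, hloc⟩ := exists_addEquiv_geomTorsion_two_localSquare_signed W hd hWd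
  have hψ' : ∀ (σ : absoluteGaloisGroup K) (Q : geomTorsion W (2 : ℤ)),
      ψ.symm (σ • Q) = σ • ψ.symm Q := fun σ Q ↦
    ψ.injective (by rw [hψ, ψ.apply_symm_apply, ψ.apply_symm_apply])
  let φ : (Wd.torsionGaloisModule ((2 : ℕ) : ℤ)).toContRepresentation →ⁱL
      (W.torsionGaloisModule ((2 : ℕ) : ℤ)).toContRepresentation :=
    { toContinuousLinearMap := ⟨ψ.toAddMonoidHom.toIntLinearMap, continuous_of_discreteTopology⟩
      isIntertwining' := fun σ ↦ by
        ext P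
        exact congrArg Subtype.val (hψ σ P) }
  let φ' : (W.torsionGaloisModule ((2 : ℕ) : ℤ)).toContRepresentation →ⁱL
      (Wd.torsionGaloisModule ((2 : ℕ) : ℤ)).toContRepresentation :=
    { toContinuousLinearMap := ⟨ψ.symm.toAddMonoidHom.toIntLinearMap, continuous_of_discreteTopology⟩
      isIntertwining' := fun σ ↦ by
        ext Q
        exact congrArg Subtype.val (hψ' σ Q) }
  have hφ : ∀ a, φ a = ψ a := fun _ ↦ rfl
  have hφ' : ∀ b, φ' b = ψ.symm b := fun _ ↦ rfl
  -- one inclusion of Lemma 2.10 (i), for an arbitrary `Γ_E`-equivariant intertwined datum (as in g8's files)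
  have key : ∀ (E : Type) [Field E] [Algebra K E] {X Y : WeierstrassCurve K}
      (χ : (X.torsionGaloisModule ((2 : ℕ) : ℤ)).toContRepresentation →ⁱL
        (Y.torsionGaloisModule ((2 : ℕ) : ℤ)).toContRepresentation) (η : localPoints X E ≃+ localPoints Y E),
      (∀ (σ : absoluteGaloisGroup E) (Q : localPoints X E), η (σ • Q) = σ • η Q) →
      (∀ t : geomTorsion X ((2 : ℕ) : ℤ),
        pointsMap Y E (χ t : geomPoints Y) = η (pointsMap X E (t : geomPoints X))) →
      ∀ x ∈ X.kummerLocalConditionAt ((2 : ℕ) : ℤ) E,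
        galoisCohomology.map (χ.restrictField E) 1 x ∈ Y.kummerLocalConditionAt ((2 : ℕ) : ℤ) E := by
    intro E _ _ X Y χ η hη hχ x hx
    obtain ⟨f, rfl⟩ := oneCocycleClass_surjective
      (DiscreteGaloisModule.toTopRep (GaloisRep.restrictField E (X.torsionGaloisModule ((2 : ℕ) : ℤ)))) x
    rw [mem_kummerLocalConditionAt_iff, map_torsionPointsMapIntertwining_oneCocycleClass] at hx
    obtain ⟨Q, hQ⟩ := (oneCocycleClass_eq_zero_iff _ _).mp hx
    have hQ' : ∀ σ : absoluteGaloisGroup E,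
        pointsMap X E ((f.1 σ : geomTorsion X ((2 : ℕ) : ℤ)) : geomPoints X) = σ • Q - Q := hQ
    rw [galoisCohomology.map_one_oneCocycleClass, mem_kummerLocalConditionAt_iff,
      map_torsionPointsMapIntertwining_oneCocycleClass]
    refine (oneCocycleClass_eq_zero_iff _ _).mpr ⟨η Q, fun σ ↦ ?_⟩
    change pointsMap Y E ((χ (f.1 σ) : geomTorsion Y ((2 : ℕ) : ℤ)) : geomPoints Y) = σ • η Q - η Q
    rw [hχ, hQ', map_sub, hη]
  refine ⟨φ, φ', fun a ↦ ψ.symm_apply_apply a, fun b ↦ ψ.apply_symm_apply b, fun E _ _ hsq ↦ ?_,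
    fun w hw hΔ hdsq ↦ ?_⟩
  · -- (i) split places: every `σ` fixes `ι(√d)`, `θ_E` is `Γ_E`-equivariant
    obtain ⟨s, hs⟩ := hsq
    obtain ⟨θ, hfix, -, -, hsquare⟩ := hloc E
    have hθ : ∀ (σ : absoluteGaloisGroup E) (Q : localPoints Wd E), θ (σ • Q) = σ • θ Q :=
      fun σ Q ↦ hfix σ (smul_closureEmb_geomSqrt_eq E hs σ) Q
    have hθ' : ∀ (σ : absoluteGaloisGroup E) (Q : localPoints W E), θ.symm (σ • Q) = σ • θ.symm Q :=
      symm_equivariant θ hθ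
    have hsquare' : ∀ t : geomTorsion W ((2 : ℕ) : ℤ),
        pointsMap Wd E (ψ.symm t : geomPoints Wd) = θ.symm (pointsMap W E (t : geomPoints W)) := fun t ↦ by
      apply θ.injective
      rw [← hsquare (ψ.symm t), ψ.apply_symm_apply, θ.apply_symm_apply]
    apply le_antisymm
    · rw [AddSubgroup.map_le_iff_le_comap]
      intro x hx
      exact key E φ θ hθ (fun t ↦ by rw [hφ]; exact hsquare t) x hx
    · intro y hy
      refine ⟨galoisCohomology.map (φ'.restrictField E) 1 y,
        key E φ' θ.symm hθ' (fun t ↦ by rw [hφ']; exact hsquare' t) y hy, ?_⟩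
      obtain ⟨f, rfl⟩ := oneCocycleClass_surjective
        (DiscreteGaloisModule.toTopRep (GaloisRep.restrictField E (W.torsionGaloisModule ((2 : ℕ) : ℤ)))) y
      rw [galoisCohomology.map_one_oneCocycleClass, galoisCohomology.map_one_oneCocycleClass]
      congr 1
      apply Subtype.ext
      ext g : 1
      rw [contOneCocycles.pullback_apply, contOneCocycles.pullback_apply]
      exact ψ.apply_symm_apply (f.1 g)
  · -- (ii) real places with `w(Δ_W) > 0`, `d` not a square in `K_w`: the untwisting anti-commutes with `σ₀`
    obtain ⟨θ, -, hneg, -, hsquare⟩ := hloc w.Completion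
    exact map_kummerLocalConditionAt_inf_eq_bot_of_neg_of_isReal W Wd hw hΔ hdsq φ θ hneg
      (fun t ↦ by rw [hφ]; exact hsquare t)

end Package

end Summit.BirchSwinnertonDyer.BirchSwinnertonDyer.Theorems.GenusKolyArch

end
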